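import Literature.Analysis.FluidPDE.CaloricLocalLeray
import Literature.Analysis.FluidPDE.WeakSpatialGradientSum
import Literature.Analysis.FluidPDE.WholeSpaceIBP
import Literature.Analysis.UnboundedOperators.HeatFlowCalculus
import Literature.Analysis.UnboundedOperators.HeatKernelStrongContinuityProofs
import Literature.Analysis.FunctionSpaces.BMOCarlesonFeffermanStein
import HarnessLib

/-!
# The caloric extension of `Lᵖ` data obeys the linear local Leray bounds

Analysis/FluidPDE proof file (theorems only) towards the discharge of the named fact
`Literature.Analysis.FluidPDE.bradshawTsai2017_caloric_localLeray` (`CaloricLocalLeray.lean`: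
Bradshaw–Tsai, Ann. Henri Poincaré 18 (2017) [BT1], §4, the heat-flow claims in the proof of
Thm 1.2). The fact says that for `v₀ ∈ L³_w(ℝ³)` the caloric extension `e^{tΔ}v₀` is an
`IsCaloricLocalLerayField v₀` (continuity on the open slab, uniformly local energy and enstrophy,
attainment of the datum in `L²_loc`, decay of the local energy at spatial infinity). The discharge
splits `v₀ = v₀𝟙_{|v₀|>1} + v₀𝟙_{|v₀|≤1} ∈ (L¹ ∩ L²) + (L⁴ ∩ L^∞)` and treats each piece by the
`Lᵖ` theory of the heat kernel of the `UnboundedOperators` trunk; this file is the `Lᵖ` layer: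

* `hasWeakSpatialGradientOn_of_hasFDerivAt` — a field that is jointly continuous on an open time
  slab together with its classical slice derivative has that derivative as weak spatial gradient
  (slice-wise integration by parts; the joint-`C¹` version is
  `hasWeakSpatialGradientOn_of_contDiffOn` of `ClassicalSuitable.lean`).
* `IsCaloricLocalLerayField.add`, `IsCaloricLocalLerayField.congr_datum` — the linear local Leray
  bounds are additive (up to equality of the fields on `t > 0`) and insensitive to a.e.
  modification of the datum.
* `setLIntegral_enorm_sq_le_measure_rpow_mul` — Hölder on a set of finite measure,
  `∫_s ‖f‖² ≤ μ(s)^{1-2/p} (∫_s ‖f‖^p)^{2/p}` for `2 ≤ p < ∞`.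
* `isCaloricLocalLerayField_heatExtension_of_memLp` — for `g ∈ Lᵖ(ℝ³; ℝ³)`, `2 ≤ p < ∞`, the
  caloric extension `e^{tΔ}g` is an `IsCaloricLocalLerayField g` **provided** the uniformly local
  enstrophy bound `sup_{x₀} ∫₀^{R²}∫_{B_R(x₀)} |∇e^{tΔ}g|² < ∞` holds for the classical gradient
  (this bound is the only clause that is not a consequence of the `Lᵖ` contraction; it is proved
  in `CaloricGradientBoxBounds.lean` for the two kinds of data of the splitting). The other
  clauses: continuity (`continuousOn_uncurry_heatExtension_of_memLp`), energy (Hölder on the ball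
  and `‖e^{tΔ}g‖_p ≤ ‖g‖_p`), datum (Hölder on `K` and `‖e^{tΔ}g − g‖_p → 0`,
  `tendsto_heatExtension_nhdsWithin_zero_holds`), decay (the finite space–time integral
  `∫₀^{R²}∫ |e^{tΔ}g|^p ≤ R²‖g‖_p^p` is exhausted by cylinders, then Hölder on the box), weak
  gradient (`hasFDerivAt_heatExtension`, joint continuity of `∂ᵥe^{tΔ}g`).

This is the standard content of Lemarié-Rieusset, *The Navier–Stokes problem in the 21st
century* (2016), proof of Thm 14.1, Step 1 (the heat flow of uniformly locally square integrable
data), specialised to `Lᵖ` data.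

## References

* Z. Bradshaw, T.-P. Tsai, Ann. Henri Poincaré 18 (2017) 1095–1119 = arXiv:1510.07504, §4
  [BradshawTsai2017AHP].
* P. G. Lemarié-Rieusset, *The Navier–Stokes problem in the 21st century*, CRC Press 2016,
  Thm 14.1 (proof, Step 1) [LemarieRieusset2016].
* L. C. Evans, *Partial differential equations*, §2.3.1, Thm 1 [Evans2010].
-/

noncomputable section

open MeasureTheory Set Function Filter Topology TopologicalSpace Metric InnerProductSpace
open scoped NNReal ENNReal RealInnerProductSpace

namespace Literature.Analysis.FluidPDE

/-! ### Weak spatial gradients from classical slice derivatives -/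

section Slices

variable {E : Type*} [NormedAddCommGroup E] [InnerProductSpace ℝ E] [FiniteDimensional ℝ E]
  [MeasurableSpace E] [BorelSpace E]

/-- **Weak spatial gradient from classical slice derivatives.** Let `Q ⊆ S × E` and let
`u : ℝ → E → E` be jointly continuous on `S × E`, differentiable in `x` on every slice `t ∈ S`
with slice derivative `G t x`, where `G` is jointly continuous on `S × E`. Then `G` is a weak
spatial gradient of `u` on `Q` (integration by parts in `x` on each time slice, no boundary
terms; Caffarelli–Kohn–Nirenberg 1982, (2.1): for smooth `u` the distributional `∇u` is the
classical one). [cite: CaffarelliKohnNirenberg1982, §2 (2.1)] -/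
theorem hasWeakSpatialGradientOn_of_hasFDerivAt {S : Set ℝ} {Q : Opens (ℝ × E)}
    (hQ : (Q : Set (ℝ × E)) ⊆ S ×ˢ univ) {u : ℝ → E → E} {G : ℝ → E → E →L[ℝ] E}
    (hu : ContinuousOn (uncurry u) (S ×ˢ univ)) (hG : ContinuousOn (uncurry G) (S ×ˢ univ))
    (hd : ∀ t ∈ S, ∀ x, HasFDerivAt (u t) (G t x) x) :
    HasWeakSpatialGradientOn Q u G where
  locallyIntegrableOn := (hu.mono hQ).locallyIntegrableOn Q.isOpen.measurableSet
  locallyIntegrableOn_grad := (hG.mono hQ).locallyIntegrableOn Q.isOpen.measurableSet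
  integral_fderiv_mul_inner_eq φ hφ v w := by
    rw [← integral_neg]
    refine integral_congr_ae (Eventually.of_forall fun t => ?_)
    by_cases ht : t ∈ S
    · have hin : ∀ x : E, (t, x) ∈ S ×ˢ (univ : Set E) := fun x => ⟨ht, mem_univ _⟩
      have hut : Continuous (u t) :=
        (hu.comp_continuous (Continuous.prodMk_right t) hin : _)
      have hGt : Continuous (G t) :=
        (hG.comp_continuous (Continuous.prodMk_right t) hin : _)
      have hφ1 : ContDiff ℝ 1 (φ t) := (hφ.contDiff_slice t).of_le (by exact_mod_cast le_top)
      have hφc : HasCompactSupport (φ t) := hφ.hasCompactSupport_slice t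
      have hfd : fderiv ℝ (u t) = G t := funext fun x => (hd t ht x).fderiv
      have hu1 : ContDiff ℝ 1 (u t) := by
        rw [contDiff_one_iff_fderiv, hfd]
        exact ⟨fun x => (hd t ht x).differentiableAt, hGt⟩
      set h : E → ℝ := fun x => φ t x * ⟪u t x, w⟫ with hh
      have hh1 : ContDiff ℝ 1 h := hφ1.mul (hu1.inner ℝ contDiff_const)
      have hhc : HasCompactSupport h := hφc.mul_right
      have h0 := integral_fderiv_apply_eq_zero hh1 hhc v
      have hD : ∀ x, fderiv ℝ h x v =
          fderiv ℝ (φ t) x v * ⟪u t x, w⟫ + φ t x * ⟪G t x v, w⟫ := by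
        intro x
        have h1 := (hd t ht x).inner ℝ (hasFDerivAt_const w x)
        have h2 : HasFDerivAt h _ x := ((hφ1.differentiable one_ne_zero x).hasFDerivAt).mul h1
        rw [h2.fderiv]
        simp only [FunLike.coe_add, FunLike.coe_smul, Pi.add_apply,
          Pi.smul_apply, smul_eq_mul, ContinuousLinearMap.comp_apply, fderivInnerCLM_apply,
          ContinuousLinearMap.prod_apply, inner_zero_right, zero_add,
          FunLike.coe_zero, Pi.zero_apply]
        ring
      have i1 : Integrable (fun x => fderiv ℝ (φ t) x v * ⟪u t x, w⟫) (volume : Measure E) :=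
        (((hφ1.continuous_fderiv one_ne_zero).clm_apply continuous_const).mul
          (hut.inner continuous_const)).integrable_of_hasCompactSupport
          ((hφc.fderiv_apply (𝕜 := ℝ) v).mul_right)
      have i2 : Integrable (fun x => φ t x * ⟪G t x v, w⟫) (volume : Measure E) :=
        (hφ1.continuous.mul ((hGt.clm_apply continuous_const).inner
          continuous_const)).integrable_of_hasCompactSupport hφc.mul_right
      simp_rw [hD] at h0
      rw [integral_add i1 i2] at h0
      linarith
    · have hφ0 : φ t = 0 := funext fun _ => hφ.apply_eq_zero fun h => ht (hQ h).1
      simp [hφ0]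

end Slices

/-! ### Hölder on a set of finite measure -/

section Holder

variable {α : Type*} [MeasurableSpace α] {μ : Measure α} {F' : Type*} [NormedAddCommGroup F']

/-- `(∫ ‖f‖^p)^{2/p} = ‖f‖_p²` (`0 < p < ∞`). [folklore] -/
theorem lintegral_rpow_enorm_rpow_two_div (f : α → F') {p : ℝ≥0∞} (hp0 : p ≠ 0)
    (hp' : p ≠ ∞) :
    (∫⁻ x, ‖f x‖ₑ ^ p.toReal ∂μ) ^ (2 / p.toReal) = eLpNorm f p μ ^ 2 := by
  have hp : 0 < p.toReal := ENNReal.toReal_pos hp0 hp'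
  rw [lintegral_rpow_enorm_eq_rpow_eLpNorm' hp, ← eLpNorm_eq_eLpNorm' hp0 hp',
    ← ENNReal.rpow_mul, mul_div_cancel₀ _ hp.ne', ENNReal.rpow_two]

/-- `∫ ‖f‖² = ‖f‖₂²` (private copy of the helper of `EnstrophySplitting.lean`, to keep the
imports of this file light). [folklore] -/
private theorem lintegral_enorm_sq_eq_eLpNorm_two_npow (f : α → F') :
    ∫⁻ x, ‖f x‖ₑ ^ 2 ∂μ = eLpNorm f 2 μ ^ 2 := by
  have h := lintegral_rpow_enorm_rpow_two_div (μ := μ) f (p := 2) two_ne_zero ENNReal.ofNat_ne_top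
  rw [ENNReal.toReal_ofNat, div_self two_ne_zero, ENNReal.rpow_one] at h
  rw [← h]
  exact lintegral_congr fun x => by rw [ENNReal.rpow_two]

/-- **Hölder on a set of finite measure**: for `2 ≤ p < ∞` and `f` a.e.-strongly measurable on
`s`, `∫_s ‖f‖² dμ ≤ μ(s)^{1 − 2/p} (∫_s ‖f‖^p dμ)^{2/p}` (Mathlib's
`eLpNorm_le_eLpNorm_mul_rpow_measure_univ` on `μ|_s`, squared). [folklore] -/
theorem setLIntegral_enorm_sq_le_measure_rpow_mul {f : α → F'} {s : Set α} {p : ℝ≥0∞}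
    (hp : 2 ≤ p) (hp' : p ≠ ∞) (hf : AEStronglyMeasurable f (μ.restrict s)) :
    ∫⁻ x in s, ‖f x‖ₑ ^ 2 ∂μ ≤
      μ s ^ (1 - 2 / p.toReal) * (∫⁻ x in s, ‖f x‖ₑ ^ p.toReal ∂μ) ^ (2 / p.toReal) := by
  have hp0 : p ≠ 0 := (lt_of_lt_of_le (by norm_num) hp).ne'
  have h := eLpNorm_le_eLpNorm_mul_rpow_measure_univ hp hf
  rw [Measure.restrict_apply_univ, ENNReal.toReal_ofNat] at h
  have h2 := pow_le_pow_left' h 2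
  rw [mul_pow, ← lintegral_enorm_sq_eq_eLpNorm_two_npow, ← lintegral_rpow_enorm_rpow_two_div f hp0 hp',
    ← ENNReal.rpow_natCast (μ s ^ _), ← ENNReal.rpow_mul] at h2
  refine h2.trans (le_of_eq ?_)
  rw [mul_comm]
  congr 2
  push_cast
  ring

end Holder

/-! ### Additivity and a.e.-invariance of the linear local Leray bounds -/

section Algebra

/-- Local notation for physical space `ℝ³ = EuclideanSpace ℝ (Fin 3)`. -/
local notation "ℝ³" => EuclideanSpace ℝ (Fin 3)

/-- The restriction of Lebesgue measure on `ℝ × ℝ³` to a product set is the product of the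
restrictions (private copy of the helper of `LocalTypeILscPressure.lean`). [folklore] -/
private theorem restrict_volume_prod_box (I : Set ℝ) (S : Set ℝ³) :
    (volume : Measure (ℝ × ℝ³)).restrict (I ×ˢ S) =
      ((volume : Measure ℝ).restrict I).prod ((volume : Measure ℝ³).restrict S) := by
  rw [Measure.volume_eq_prod, Measure.prod_restrict]

/-- A field continuous on the open slab `(0,∞) × ℝ³` is a.e.-strongly measurable on every box
`(0,T) × S` (`S` measurable). [folklore] -/
theorem aestronglyMeasurable_uncurry_restrict_box {F' : Type*} [NormedAddCommGroup F']
    {V : ℝ → ℝ³ → F'} (hV : ContinuousOn (uncurry V) (Ioi (0 : ℝ) ×ˢ (univ : Set ℝ³)))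
    (T : ℝ) {S : Set ℝ³} (hS : MeasurableSet S) :
    AEStronglyMeasurable (uncurry V) (volume.restrict (Ioo 0 T ×ˢ S)) :=
  (hV.mono (prod_mono Ioo_subset_Ioi_self (subset_univ _))).aestronglyMeasurable
    (measurableSet_Ioo.prod hS)

/-- Slices `V t`, `t > 0`, of a field continuous on the open slab are continuous. [folklore] -/
theorem continuous_slice_of_continuousOn_slab {F' : Type*} [TopologicalSpace F']
    {V : ℝ → ℝ³ → F'} (hV : ContinuousOn (uncurry V) (Ioi (0 : ℝ) ×ˢ (univ : Set ℝ³)))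
    {t : ℝ} (ht : 0 < t) : Continuous (V t) :=
  (hV.comp_continuous (Continuous.prodMk_right t) fun x => ⟨ht, mem_univ x⟩ : _)

/-- **Additivity of the linear local Leray bounds.** If `V` has the bounds with datum `g` and
`W` with datum `h` (`h` a.e.-strongly measurable), and `U = V + W` on `t > 0`, then `U` has the
bounds with datum `g + h` (every clause is subadditive: `|a+b|² ≤ 2|a|² + 2|b|²`,
`|A+B|²_F ≤ 2|A|²_F + 2|B|²_F`, and weak spatial gradients add). [folklore] -/
theorem IsCaloricLocalLerayField.add {g h : ℝ³ → ℝ³} {V W U : ℝ → ℝ³ → ℝ³}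
    (hV : IsCaloricLocalLerayField g V) (hW : IsCaloricLocalLerayField h W)
    (hh : AEStronglyMeasurable h volume)
    (hU : ∀ t : ℝ, 0 < t → ∀ x, U t x = V t x + W t x) :
    IsCaloricLocalLerayField (g + h) U where
  continuousOn := by
    refine (hV.continuousOn.add hW.continuousOn).congr fun z hz => ?_
    exact hU z.1 (mem_prod.1 hz).1 z.2
  uniformLocalEnergy R hR := by
    obtain ⟨C₁, hC₁⟩ := hV.uniformLocalEnergy R hR
    obtain ⟨C₂, hC₂⟩ := hW.uniformLocalEnergy R hR
    refine ⟨2 * C₁ + 2 * C₂, fun t ht x₀ => ?_⟩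
    have hWc : Continuous (W t) := continuous_slice_of_continuousOn_slab hW.continuousOn ht.1
    have hmeas : AEMeasurable (fun x => 2 * ‖W t x‖ₑ ^ 2) (volume.restrict (ball x₀ R)) :=
      ((hWc.measurable.enorm.pow_const 2).const_mul 2).aemeasurable
    calc ∫⁻ x in ball x₀ R, ‖U t x‖ₑ ^ 2
        ≤ ∫⁻ x in ball x₀ R, (2 * ‖V t x‖ₑ ^ 2 + 2 * ‖W t x‖ₑ ^ 2) := by
          refine lintegral_mono fun x => ?_
          rw [hU t ht.1 x]
          exact FunctionSpaces.BMOInv.enorm_add_sq_le _ _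
      _ = (∫⁻ x in ball x₀ R, 2 * ‖V t x‖ₑ ^ 2) + ∫⁻ x in ball x₀ R, 2 * ‖W t x‖ₑ ^ 2 :=
          lintegral_add_right' _ hmeas
      _ ≤ 2 * C₁ + 2 * C₂ := by
          rw [lintegral_const_mul' _ _ ENNReal.ofNat_ne_top,
            lintegral_const_mul' _ _ ENNReal.ofNat_ne_top]
          gcongr
          exacts [hC₁ t ht x₀, hC₂ t ht x₀]
      _ = ((2 * C₁ + 2 * C₂ : ℝ≥0) : ℝ≥0∞) := by push_cast; rfl
  uniformLocalGradient := by
    obtain ⟨H₁, hH₁, hb₁⟩ := hV.uniformLocalGradient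
    obtain ⟨H₂, hH₂, hb₂⟩ := hW.uniformLocalGradient
    refine ⟨fun t x => H₁ t x + H₂ t x, ?_, fun R hR => ?_⟩
    · exact (hH₁.add hH₂).congr_eqOn fun z hz => hU z.1 (mem_prod.1 hz).1 z.2
    · obtain ⟨C₁, hC₁⟩ := hb₁ R hR
      obtain ⟨C₂, hC₂⟩ := hb₂ R hR
      refine ⟨2 * C₁ + 2 * C₂, fun x₀ => ?_⟩
      -- measurability of the second summand on the box
      have hsub : Ioo 0 (R ^ 2) ×ˢ ball x₀ R ⊆
          ((slab ℝ³ (Ioi 0) isOpen_Ioi : Opens (ℝ × ℝ³)) : Set (ℝ × ℝ³)) := by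
        rw [coe_slab]; exact prod_mono Ioo_subset_Ioi_self (subset_univ _)
      have hH₂m : AEStronglyMeasurable (uncurry H₂)
          (volume.restrict (Ioo 0 (R ^ 2) ×ˢ ball x₀ R)) :=
        (hH₂.locallyIntegrableOn_grad.aestronglyMeasurable).mono_measure
          (Measure.restrict_mono hsub le_rfl)
      have hmeas : AEMeasurable
          (fun z : ℝ × ℝ³ => 2 * ENNReal.ofReal (frobeniusNormSq (H₂ z.1 z.2)))
          (volume.restrict (Ioo 0 (R ^ 2) ×ˢ ball x₀ R)) := by
        have hc : Continuous fun L : ℝ³ →L[ℝ] ℝ³ => frobeniusNormSq L := by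
          unfold frobeniusNormSq; fun_prop
        exact ((hc.comp_aestronglyMeasurable hH₂m).aemeasurable.ennreal_ofReal).const_mul 2
      calc ∫⁻ z in Ioo 0 (R ^ 2) ×ˢ ball x₀ R,
            ENNReal.ofReal (frobeniusNormSq (H₁ z.1 z.2 + H₂ z.1 z.2))
          ≤ ∫⁻ z in Ioo 0 (R ^ 2) ×ˢ ball x₀ R,
              (2 * ENNReal.ofReal (frobeniusNormSq (H₁ z.1 z.2)) +
                2 * ENNReal.ofReal (frobeniusNormSq (H₂ z.1 z.2))) := by
            refine lintegral_mono fun z => ?_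
            refine (ENNReal.ofReal_le_ofReal (frobeniusNormSq_add_le _ _)).trans (le_of_eq ?_)
            rw [ENNReal.ofReal_add (by positivity [frobeniusNormSq_nonneg (H₁ z.1 z.2)])
              (by positivity [frobeniusNormSq_nonneg (H₂ z.1 z.2)]),
              ENNReal.ofReal_mul zero_le_two, ENNReal.ofReal_mul zero_le_two, ENNReal.ofReal_ofNat]
        _ = (∫⁻ z in Ioo 0 (R ^ 2) ×ˢ ball x₀ R, 2 * ENNReal.ofReal (frobeniusNormSq (H₁ z.1 z.2))) +
              ∫⁻ z in Ioo 0 (R ^ 2) ×ˢ ball x₀ R, 2 * ENNReal.ofReal (frobeniusNormSq (H₂ z.1 z.2)) :=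
            lintegral_add_right' _ hmeas
        _ ≤ 2 * C₁ + 2 * C₂ := by
            rw [lintegral_const_mul' _ _ ENNReal.ofNat_ne_top,
              lintegral_const_mul' _ _ ENNReal.ofNat_ne_top]
            gcongr
            exacts [hC₁ x₀, hC₂ x₀]
        _ = ((2 * C₁ + 2 * C₂ : ℝ≥0) : ℝ≥0∞) := by push_cast; rfl
  initial K hK := by
    have h1 := ENNReal.Tendsto.const_mul (a := (2 : ℝ≥0∞)) (hV.initial K hK)
      (Or.inr ENNReal.ofNat_ne_top)
    have h2 := ENNReal.Tendsto.const_mul (a := (2 : ℝ≥0∞)) (hW.initial K hK)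
      (Or.inr ENNReal.ofNat_ne_top)
    rw [mul_zero] at h1 h2
    have h12 := h1.add h2
    rw [add_zero] at h12
    refine tendsto_of_tendsto_of_tendsto_of_le_of_le' tendsto_const_nhds h12
      (Eventually.of_forall fun t => bot_le) ?_
    filter_upwards [self_mem_nhdsWithin] with t ht
    have hWc : Continuous (W t) := continuous_slice_of_continuousOn_slab hW.continuousOn ht
    have hmeas : AEMeasurable (fun x => 2 * ‖W t x - h x‖ₑ ^ 2) (volume.restrict K) :=
      (((hWc.aestronglyMeasurable.sub hh).enorm.pow_const 2).const_mul 2).restrict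
    calc ∫⁻ x in K, ‖U t x - (g + h) x‖ₑ ^ 2
        ≤ ∫⁻ x in K, (2 * ‖V t x - g x‖ₑ ^ 2 + 2 * ‖W t x - h x‖ₑ ^ 2) := by
          refine lintegral_mono fun x => ?_
          rw [hU t ht x, Pi.add_apply, add_sub_add_comm]
          exact FunctionSpaces.BMOInv.enorm_add_sq_le _ _
      _ = (∫⁻ x in K, 2 * ‖V t x - g x‖ₑ ^ 2) + ∫⁻ x in K, 2 * ‖W t x - h x‖ₑ ^ 2 :=
          lintegral_add_right' _ hmeas
      _ = 2 * (∫⁻ x in K, ‖V t x - g x‖ₑ ^ 2) + 2 * ∫⁻ x in K, ‖W t x - h x‖ₑ ^ 2 := by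
          rw [lintegral_const_mul' _ _ ENNReal.ofNat_ne_top,
            lintegral_const_mul' _ _ ENNReal.ofNat_ne_top]
  decay R hR := by
    have h1 := ENNReal.Tendsto.const_mul (a := (2 : ℝ≥0∞)) (hV.decay R hR)
      (Or.inr ENNReal.ofNat_ne_top)
    have h2 := ENNReal.Tendsto.const_mul (a := (2 : ℝ≥0∞)) (hW.decay R hR)
      (Or.inr ENNReal.ofNat_ne_top)
    rw [mul_zero] at h1 h2
    have h12 := h1.add h2
    rw [add_zero] at h12
    refine tendsto_of_tendsto_of_tendsto_of_le_of_le tendsto_const_nhds h12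
      (fun x₀ => bot_le) fun x₀ => ?_
    have hmeas : AEMeasurable (fun z : ℝ × ℝ³ => 2 * ‖W z.1 z.2‖ₑ ^ 2)
        (volume.restrict (Ioo 0 (R ^ 2) ×ˢ ball x₀ R)) :=
      (((aestronglyMeasurable_uncurry_restrict_box hW.continuousOn (R ^ 2)
        measurableSet_ball).enorm.pow_const 2).const_mul 2)
    calc ∫⁻ z in Ioo 0 (R ^ 2) ×ˢ ball x₀ R, ‖U z.1 z.2‖ₑ ^ 2
        ≤ ∫⁻ z in Ioo 0 (R ^ 2) ×ˢ ball x₀ R, (2 * ‖V z.1 z.2‖ₑ ^ 2 + 2 * ‖W z.1 z.2‖ₑ ^ 2) := by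
          refine setLIntegral_mono' (measurableSet_Ioo.prod measurableSet_ball) fun z hz => ?_
          rw [hU z.1 (mem_prod.1 hz).1.1 z.2]
          exact FunctionSpaces.BMOInv.enorm_add_sq_le _ _
      _ = (∫⁻ z in Ioo 0 (R ^ 2) ×ˢ ball x₀ R, 2 * ‖V z.1 z.2‖ₑ ^ 2) +
            ∫⁻ z in Ioo 0 (R ^ 2) ×ˢ ball x₀ R, 2 * ‖W z.1 z.2‖ₑ ^ 2 :=
          lintegral_add_right' _ hmeas
      _ = 2 * (∫⁻ z in Ioo 0 (R ^ 2) ×ˢ ball x₀ R, ‖V z.1 z.2‖ₑ ^ 2) +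
            2 * ∫⁻ z in Ioo 0 (R ^ 2) ×ˢ ball x₀ R, ‖W z.1 z.2‖ₑ ^ 2 := by
          rw [lintegral_const_mul' _ _ ENNReal.ofNat_ne_top,
            lintegral_const_mul' _ _ ENNReal.ofNat_ne_top]

/-- **The linear local Leray bounds only see the datum up to a null set** (the datum enters only
through `∫_K |V(t) − v₀|²`). [folklore] -/
theorem IsCaloricLocalLerayField.congr_datum {g g' : ℝ³ → ℝ³} {V : ℝ → ℝ³ → ℝ³}
    (hV : IsCaloricLocalLerayField g V) (hg : g' =ᵐ[volume] g) :
    IsCaloricLocalLerayField g' V where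
  continuousOn := hV.continuousOn
  uniformLocalEnergy := hV.uniformLocalEnergy
  uniformLocalGradient := hV.uniformLocalGradient
  initial K hK := by
    refine (hV.initial K hK).congr fun t => ?_
    refine lintegral_congr_ae ?_
    filter_upwards [ae_restrict_of_ae (s := K) hg] with x hx
    rw [hx]
  decay := hV.decay


end Algebra

/-! ### The caloric extension of `Lᵖ` data -/

section LpData

/-- Local notation for physical space `ℝ³ = EuclideanSpace ℝ (Fin 3)`. -/
local notation "ℝ³" => EuclideanSpace ℝ (Fin 3)

open UnboundedOperators

variable {g : ℝ³ → ℝ³} {p : ℝ≥0∞}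

/-- For `2 ≤ p < ∞`, the Hölder exponent `1 − 2/p` is nonnegative. [folklore] -/
theorem sub_two_div_toReal_nonneg (hp : 2 ≤ p) (hp' : p ≠ ∞) : 0 ≤ 1 - 2 / p.toReal := by
  have h2 : (2 : ℝ) ≤ p.toReal := by
    have := ENNReal.toReal_mono hp' hp
    rwa [ENNReal.toReal_ofNat] at this
  have : 2 / p.toReal ≤ 1 := (div_le_one (by linarith)).2 h2
  linarith

/-- Slices `e^{tΔ}g`, `t > 0`, of the caloric extension of `Lᵖ` data are continuous
(indeed smooth, `contDiff_heatExtension_holds`). [folklore] -/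
theorem continuous_heatExtension_of_memLp (hg : MemLp g p volume) (hp : 1 ≤ p) {t : ℝ}
    (ht : 0 < t) : Continuous (heatExtension g t) :=
  (contDiff_heatExtension_holds hg hp ht).continuous

/-- **Uniformly local energy of the caloric extension of `Lᵖ` data** (`2 ≤ p < ∞`, `t > 0`):
`∫_{B_R(x₀)} |e^{tΔ}g|² ≤ |B_R|^{1−2/p} ‖g‖_p²` (Hölder on the ball and the `Lᵖ` contraction
`‖e^{tΔ}g‖_p ≤ ‖g‖_p`; Lemarié-Rieusset 2016, proof of Thm 14.1, Step 1, for `L²_uloc`). [cite: LemarieRieusset2016, Theorem 14.1 (proof, Step 1)] -/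
theorem setLIntegral_ball_enorm_heatExtension_sq_le (hp : 2 ≤ p) (hp' : p ≠ ∞)
    (hg : MemLp g p volume) {t : ℝ} (ht : 0 < t) (x₀ : ℝ³) (R : ℝ) :
    ∫⁻ x in ball x₀ R, ‖heatExtension g t x‖ₑ ^ 2 ≤
      volume (ball (0 : ℝ³) R) ^ (1 - 2 / p.toReal) * eLpNorm g p volume ^ 2 := by
  have hp1 : 1 ≤ p := one_le_two.trans hp
  have hp0 : p ≠ 0 := (zero_lt_one.trans_le hp1).ne'
  have hc : Continuous (heatExtension g t) := continuous_heatExtension_of_memLp hg hp1 ht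
  calc ∫⁻ x in ball x₀ R, ‖heatExtension g t x‖ₑ ^ 2
      ≤ volume (ball x₀ R) ^ (1 - 2 / p.toReal) *
          (∫⁻ x in ball x₀ R, ‖heatExtension g t x‖ₑ ^ p.toReal) ^ (2 / p.toReal) :=
        setLIntegral_enorm_sq_le_measure_rpow_mul hp hp' hc.aestronglyMeasurable.restrict
    _ ≤ volume (ball (0 : ℝ³) R) ^ (1 - 2 / p.toReal) *
          (∫⁻ x, ‖heatExtension g t x‖ₑ ^ p.toReal) ^ (2 / p.toReal) := by
        rw [Measure.addHaar_ball_center]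
        gcongr
        exact Measure.restrict_le_self
    _ = volume (ball (0 : ℝ³) R) ^ (1 - 2 / p.toReal) *
          eLpNorm (heatExtension g t) p volume ^ 2 := by
        rw [lintegral_rpow_enorm_rpow_two_div _ hp0 hp']
    _ ≤ volume (ball (0 : ℝ³) R) ^ (1 - 2 / p.toReal) * eLpNorm g p volume ^ 2 := by
        gcongr
        exact eLpNorm_heatExtension_le_holds hg hp1 ht

/-- **The datum is attained in `L²_loc`**: for `g ∈ Lᵖ`, `2 ≤ p < ∞`, and `K` compact,
`∫_K |e^{tΔ}g − g|² ≤ |K|^{1−2/p} ‖e^{tΔ}g − g‖_p² → 0` as `t → 0⁺` (strong continuity of the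
heat semigroup on `Lᵖ`, `tendsto_heatExtension_nhdsWithin_zero_holds`). [cite: LemarieRieusset2016, Theorem 14.1 (proof, Step 1)] -/
theorem tendsto_setLIntegral_enorm_heatExtension_sub_sq (hp : 2 ≤ p) (hp' : p ≠ ∞)
    (hg : MemLp g p volume) {K : Set ℝ³} (hK : IsCompact K) :
    Tendsto (fun t => ∫⁻ x in K, ‖heatExtension g t x - g x‖ₑ ^ 2) (𝓝[>] 0) (𝓝 0) := by
  have hp1 : 1 ≤ p := one_le_two.trans hp
  have hp0 : p ≠ 0 := (zero_lt_one.trans_le hp1).ne'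
  set c : ℝ≥0∞ := volume K ^ (1 - 2 / p.toReal) with hc_def
  have hc : c ≠ ⊤ :=
    ENNReal.rpow_ne_top_of_nonneg (sub_two_div_toReal_nonneg hp hp') hK.measure_lt_top.ne
  have hlim := tendsto_heatExtension_nhdsWithin_zero_holds hg hp1 hp'
  have h2 : Tendsto (fun t => c * eLpNorm (heatExtension g t - g) p volume ^ 2)
      (𝓝[>] 0) (𝓝 0) := by
    have h := ((ENNReal.continuous_pow 2).tendsto 0).comp hlim
    rw [zero_pow two_ne_zero] at h
    have h' := ENNReal.Tendsto.const_mul h (Or.inr hc)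
    rwa [mul_zero] at h'
  refine tendsto_of_tendsto_of_tendsto_of_le_of_le' tendsto_const_nhds h2
    (Eventually.of_forall fun t => bot_le) ?_
  filter_upwards [self_mem_nhdsWithin] with t ht
  have hmeas : AEStronglyMeasurable (fun x => heatExtension g t x - g x) (volume.restrict K) :=
    ((continuous_heatExtension_of_memLp hg hp1 ht).aestronglyMeasurable.sub hg.1).restrict
  calc ∫⁻ x in K, ‖heatExtension g t x - g x‖ₑ ^ 2
      ≤ volume K ^ (1 - 2 / p.toReal) *
          (∫⁻ x in K, ‖heatExtension g t x - g x‖ₑ ^ p.toReal) ^ (2 / p.toReal) :=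
        setLIntegral_enorm_sq_le_measure_rpow_mul hp hp' hmeas
    _ ≤ c * (∫⁻ x, ‖heatExtension g t x - g x‖ₑ ^ p.toReal) ^ (2 / p.toReal) := by
        gcongr
        exact Measure.restrict_le_self
    _ = c * eLpNorm (heatExtension g t - g) p volume ^ 2 := by
        rw [← lintegral_rpow_enorm_rpow_two_div (heatExtension g t - g) hp0 hp']
        rfl

/-- **Finite space–time `Lᵖ` mass on a strip**: for `g ∈ Lᵖ`, `1 ≤ p < ∞`,
`∫₀ᵀ ∫ |e^{tΔ}g|^p dx dt ≤ T ‖g‖_p^p` (Tonelli and the `Lᵖ` contraction). [folklore] -/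
theorem lintegral_strip_enorm_heatExtension_rpow_le (hg : MemLp g p volume) (hp1 : 1 ≤ p)
    (hp' : p ≠ ∞) (T : ℝ) :
    ∫⁻ z in Ioo 0 T ×ˢ (univ : Set ℝ³), ‖heatExtension g z.1 z.2‖ₑ ^ p.toReal ≤
      volume (Ioo (0 : ℝ) T) * eLpNorm g p volume ^ p.toReal := by
  have hp0 : p ≠ 0 := (zero_lt_one.trans_le hp1).ne'
  rw [restrict_volume_prod_box, Measure.restrict_univ]
  calc ∫⁻ z, ‖heatExtension g z.1 z.2‖ₑ ^ p.toReal ∂((volume.restrict (Ioo 0 T)).prod volume)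
      ≤ ∫⁻ t in Ioo 0 T, ∫⁻ y, ‖heatExtension g t y‖ₑ ^ p.toReal := lintegral_prod_le _
    _ ≤ ∫⁻ t in Ioo 0 T, eLpNorm g p volume ^ p.toReal := by
        refine setLIntegral_mono' measurableSet_Ioo fun t ht => ?_
        rw [lintegral_rpow_enorm_eq_rpow_eLpNorm' (ENNReal.toReal_pos hp0 hp'),
          ← eLpNorm_eq_eLpNorm' hp0 hp']
        gcongr
        exact eLpNorm_heatExtension_le_holds hg hp1 ht.1
    _ = volume (Ioo (0 : ℝ) T) * eLpNorm g p volume ^ p.toReal := by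
        rw [setLIntegral_const, mul_comm]

/-- **Tails of the finite space–time `Lᵖ` mass**: `∫₀ᵀ∫_{|x| ≥ n} |e^{tΔ}g|^p → 0` as `n → ∞`
(the finite integral over the strip is exhausted by the cylinders `(0,T) × B_n`). [folklore] -/
theorem tendsto_lintegral_tail_enorm_heatExtension_rpow (hg : MemLp g p volume) (hp1 : 1 ≤ p)
    (hp' : p ≠ ∞) (T : ℝ) :
    Tendsto (fun n : ℕ => ∫⁻ z in Ioo 0 T ×ˢ (ball (0 : ℝ³) n)ᶜ,
      ‖heatExtension g z.1 z.2‖ₑ ^ p.toReal) atTop (𝓝 0) := by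
  set f : ℝ × ℝ³ → ℝ≥0∞ := fun z => ‖heatExtension g z.1 z.2‖ₑ ^ p.toReal with hf
  set μ : Measure (ℝ × ℝ³) := volume.restrict (Ioo 0 T ×ˢ (univ : Set ℝ³)) with hμ
  have hI : ∫⁻ z, f z ∂μ < ⊤ :=
    (lintegral_strip_enorm_heatExtension_rpow_le hg hp1 hp' T).trans_lt
      (ENNReal.mul_lt_top measure_Ioo_lt_top
        (ENNReal.rpow_lt_top_of_nonneg ENNReal.toReal_nonneg hg.eLpNorm_ne_top))
  set A : ℕ → Set (ℝ × ℝ³) := fun n => (univ : Set ℝ) ×ˢ ball (0 : ℝ³) n with hA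
  have hAm : ∀ n, MeasurableSet (A n) := fun n => MeasurableSet.univ.prod measurableSet_ball
  have hμA : ∀ S : Set ℝ³, μ.restrict ((univ : Set ℝ) ×ˢ S) =
      volume.restrict (Ioo 0 T ×ˢ S) := by
    intro S
    rw [hμ, Measure.restrict_restrict' (measurableSet_Ioo.prod MeasurableSet.univ), prod_inter_prod,
      univ_inter, inter_univ]
  have hdir : Directed (· ⊆ ·) A := by
    refine Monotone.directed_le fun m n hmn => prod_mono Subset.rfl (ball_subset_ball ?_)
    exact_mod_cast hmn
  have hUnion : (⋃ n, A n) = univ := by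
    refine eq_univ_of_forall fun z => mem_iUnion.2 ?_
    obtain ⟨n, hn⟩ := exists_nat_gt ‖z.2‖
    exact ⟨n, mem_univ _, mem_ball_zero_iff.2 hn⟩
  have hsup : ∫⁻ z, f z ∂μ = ⨆ n, ∫⁻ z in A n, f z ∂μ := by
    rw [← setLIntegral_iUnion_of_directed f hdir, hUnion, Measure.restrict_univ]
  have hmono : Monotone fun n => ∫⁻ z in A n, f z ∂μ := fun m n hmn =>
    lintegral_mono_set (prod_mono Subset.rfl (ball_subset_ball (by exact_mod_cast hmn)))
  have hJ : Tendsto (fun n => ∫⁻ z in A n, f z ∂μ) atTop (𝓝 (∫⁻ z, f z ∂μ)) := by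
    rw [hsup]; exact tendsto_atTop_iSup hmono
  have htail : ∀ n, ∫⁻ z in (A n)ᶜ, f z ∂μ = ∫⁻ z, f z ∂μ - ∫⁻ z in A n, f z ∂μ := fun n =>
    setLIntegral_compl (hAm n) (lt_of_le_of_lt (setLIntegral_le_lintegral _ _) hI).ne
  have hlim : Tendsto (fun n => ∫⁻ z in (A n)ᶜ, f z ∂μ) atTop (𝓝 0) := by
    simp_rw [htail]
    have := ENNReal.Tendsto.sub tendsto_const_nhds hJ (Or.inl hI.ne)
    rwa [tsub_self] at this
  refine hlim.congr fun n => ?_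
  have hcompl : (A n)ᶜ = (univ : Set ℝ) ×ˢ (ball (0 : ℝ³) n)ᶜ := by
    rw [hA, compl_prod_eq_union, compl_univ, empty_prod, empty_union]
  rw [hcompl, hμA]

/-- The box integrals `∫₀ᵀ∫_{B_R(x₀)} |e^{tΔ}g|^p` tend to `0` as `|x₀| → ∞`
(`B_R(x₀) ⊆ {|x| ≥ n}` once `|x₀| ≥ n + R`). [folklore] -/
theorem tendsto_cocompact_box_enorm_heatExtension_rpow (hg : MemLp g p volume) (hp1 : 1 ≤ p)
    (hp' : p ≠ ∞) (T R : ℝ) :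
    Tendsto (fun x₀ : ℝ³ => ∫⁻ z in Ioo 0 T ×ˢ ball x₀ R,
      ‖heatExtension g z.1 z.2‖ₑ ^ p.toReal) (cocompact ℝ³) (𝓝 0) := by
  refine ENNReal.tendsto_nhds_zero.2 fun ε hε => ?_
  obtain ⟨N, hN⟩ := (ENNReal.tendsto_atTop_zero.1
    (tendsto_lintegral_tail_enorm_heatExtension_rpow hg hp1 hp' T)) ε hε
  have hmem : (closedBall (0 : ℝ³) (N + R))ᶜ ∈ cocompact ℝ³ :=
    (isCompact_closedBall (0 : ℝ³) (N + R)).compl_mem_cocompact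
  filter_upwards [hmem] with x₀ hx₀
  have hsub : ball x₀ R ⊆ (ball (0 : ℝ³) N)ᶜ := by
    intro y hy
    rw [mem_compl_iff, mem_closedBall_zero_iff, not_le] at hx₀
    rw [mem_compl_iff, mem_ball_zero_iff, not_lt]
    rw [mem_ball_iff_norm] at hy
    have := norm_sub_norm_le x₀ y
    rw [norm_sub_rev] at this
    linarith
  exact (lintegral_mono_set (prod_mono Subset.rfl hsub)).trans (hN N le_rfl)

/-- **Decay of the local energy of the caloric extension at spatial infinity**: for `g ∈ Lᵖ`,
`2 ≤ p < ∞`, `∫₀^{R²}∫_{B_R(x₀)} |e^{tΔ}g|² → 0` as `|x₀| → ∞` (Hölder on the box against the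
vanishing `Lᵖ` box mass; Lemarié-Rieusset 2016, Def. 14.2 / Thm 14.3 for `E²` data). [cite: LemarieRieusset2016, Theorem 14.1 (proof, Step 1)] -/
theorem tendsto_cocompact_box_enorm_heatExtension_sq (hp : 2 ≤ p) (hp' : p ≠ ∞)
    (hg : MemLp g p volume) (R : ℝ) :
    Tendsto (fun x₀ : ℝ³ => ∫⁻ z in Ioo 0 (R ^ 2) ×ˢ ball x₀ R,
      ‖heatExtension g z.1 z.2‖ₑ ^ 2) (cocompact ℝ³) (𝓝 0) := by
  have hp1 : 1 ≤ p := one_le_two.trans hp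
  set c : ℝ≥0∞ := (volume (Ioo (0 : ℝ) (R ^ 2)) * volume (ball (0 : ℝ³) R)) ^ (1 - 2 / p.toReal)
    with hc_def
  have hc : c ≠ ⊤ := ENNReal.rpow_ne_top_of_nonneg (sub_two_div_toReal_nonneg hp hp')
    (ENNReal.mul_ne_top measure_Ioo_lt_top.ne measure_ball_lt_top.ne)
  have hlim := tendsto_cocompact_box_enorm_heatExtension_rpow hg hp1 hp' (R ^ 2) R
  have h2 : Tendsto (fun x₀ : ℝ³ => c * (∫⁻ z in Ioo 0 (R ^ 2) ×ˢ ball x₀ R,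
      ‖heatExtension g z.1 z.2‖ₑ ^ p.toReal) ^ (2 / p.toReal)) (cocompact ℝ³) (𝓝 0) := by
    have h := ((ENNReal.continuous_rpow_const (y := 2 / p.toReal)).tendsto 0).comp hlim
    have hpos : 0 < 2 / p.toReal :=
      div_pos two_pos (ENNReal.toReal_pos (zero_lt_one.trans_le hp1).ne' hp')
    rw [ENNReal.zero_rpow_of_pos hpos] at h
    have h' := ENNReal.Tendsto.const_mul h (Or.inr hc)
    rwa [mul_zero] at h'
  refine tendsto_of_tendsto_of_tendsto_of_le_of_le tendsto_const_nhds h2 (fun _ => bot_le)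
    fun x₀ => ?_
  have hmeas : AEStronglyMeasurable (uncurry (heatExtension g))
      (volume.restrict (Ioo 0 (R ^ 2) ×ˢ ball x₀ R)) :=
    aestronglyMeasurable_uncurry_restrict_box (V := heatExtension g)
      (continuousOn_uncurry_heatExtension_of_memLp hg hp1) _ measurableSet_ball
  have hvol : volume (Ioo 0 (R ^ 2) ×ˢ ball x₀ R) =
      volume (Ioo (0 : ℝ) (R ^ 2)) * volume (ball (0 : ℝ³) R) := by
    rw [← Measure.addHaar_ball_center volume x₀, Measure.volume_eq_prod, Measure.prod_prod]
  calc ∫⁻ z in Ioo 0 (R ^ 2) ×ˢ ball x₀ R, ‖heatExtension g z.1 z.2‖ₑ ^ 2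
      ≤ volume (Ioo 0 (R ^ 2) ×ˢ ball x₀ R) ^ (1 - 2 / p.toReal) *
          (∫⁻ z in Ioo 0 (R ^ 2) ×ˢ ball x₀ R, ‖heatExtension g z.1 z.2‖ₑ ^ p.toReal) ^
            (2 / p.toReal) :=
        setLIntegral_enorm_sq_le_measure_rpow_mul hp hp' hmeas
    _ = _ := by rw [hvol]

/-- **The classical gradient of the caloric extension of `Lᵖ` data is a weak spatial gradient on
the open slab** `(0,∞) × ℝ³` (slices are `C¹`, `hasFDerivAt_heatExtension`; `e^{tΔ}g` and
`∂ᵥe^{tΔ}g` are jointly continuous on the slab). [folklore] -/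
theorem hasWeakSpatialGradientOn_heatExtension_of_memLp (hg : MemLp g p volume) (hp1 : 1 ≤ p) :
    HasWeakSpatialGradientOn (slab ℝ³ (Ioi 0) isOpen_Ioi) (heatExtension g)
      (fun t x => fderiv ℝ (heatExtension g t) x) := by
  refine hasWeakSpatialGradientOn_of_hasFDerivAt (S := Ioi 0)
    (coe_slab (X := ℝ³) (Ioi 0) isOpen_Ioi).le
    (continuousOn_uncurry_heatExtension_of_memLp hg hp1) ?_ fun t ht x => ?_
  · show ContinuousOn (fun z : ℝ × ℝ³ => fderiv ℝ (heatExtension g z.1) z.2) (Ioi 0 ×ˢ univ)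
    exact continuousOn_clm_apply.2 fun v =>
      continuousOn_uncurry_fderiv_heatExtension_of_memLp hg hp1 v
  · exact (hasFDerivAt_heatExtension hg hp1 ht x).differentiableAt.hasFDerivAt

/-- **The caloric extension of `Lᵖ` data obeys the linear local Leray bounds, given the
uniformly local enstrophy bound.** For `g ∈ Lᵖ(ℝ³; ℝ³)`, `2 ≤ p < ∞`, if the classical gradient
satisfies `sup_{x₀} ∫₀^{R²}∫_{B_R(x₀)} |∇e^{tΔ}g|² < ∞` for every `R > 0`, then `e^{tΔ}g` is an
`IsCaloricLocalLerayField g` (continuity, uniformly local energy, datum, decay from the `Lᵖ`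
theory of the heat kernel; Lemarié-Rieusset 2016, proof of Thm 14.1, Step 1). [cite: LemarieRieusset2016, Theorem 14.1 (proof, Step 1)] -/
theorem isCaloricLocalLerayField_heatExtension_of_memLp (hp : 2 ≤ p) (hp' : p ≠ ∞)
    (hg : MemLp g p volume)
    (hgrad : ∀ R : ℝ, 0 < R → ∃ C : ℝ≥0, ∀ x₀ : ℝ³,
      ∫⁻ z in Ioo 0 (R ^ 2) ×ˢ ball x₀ R,
        ENNReal.ofReal (frobeniusNormSq (fderiv ℝ (heatExtension g z.1) z.2)) ≤ C) :
    IsCaloricLocalLerayField g (heatExtension g) where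
  continuousOn := continuousOn_uncurry_heatExtension_of_memLp hg (one_le_two.trans hp)
  uniformLocalEnergy R hR := by
    set C : ℝ≥0∞ := volume (ball (0 : ℝ³) R) ^ (1 - 2 / p.toReal) * eLpNorm g p volume ^ 2
      with hC_def
    have hC : C ≠ ⊤ := ENNReal.mul_ne_top
      (ENNReal.rpow_ne_top_of_nonneg (sub_two_div_toReal_nonneg hp hp') measure_ball_lt_top.ne)
      (ENNReal.pow_ne_top hg.eLpNorm_ne_top)
    refine ⟨C.toNNReal, fun t ht x₀ => ?_⟩
    rw [ENNReal.coe_toNNReal hC]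
    exact setLIntegral_ball_enorm_heatExtension_sq_le hp hp' hg ht.1 x₀ R
  uniformLocalGradient :=
    ⟨_, hasWeakSpatialGradientOn_heatExtension_of_memLp hg (one_le_two.trans hp), hgrad⟩
  initial K hK := tendsto_setLIntegral_enorm_heatExtension_sub_sq hp hp' hg hK
  decay R hR := tendsto_cocompact_box_enorm_heatExtension_sq hp hp' hg R

end LpData

end Literature.Analysis.FluidPDE
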